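import Mathlib
import HarnessLib
import Summits.HubbardSuperconductivity.HubbardSuperconductivity.Theorems.KLProgrammeKLRegimeTwoVolumeTowerBaseAliveBlockRows

/-!
# Route `KLProgramme` — crux K3, VL child `KLRegimeVolumeLimitV17F2` (stmt-HubbardSuperconductivity-20440), base of the two-volume tower:
# WEIGHTED ROWS AND COLUMNS OF A GENERAL OVERLAP BLOCK `ε • E(F)·S_{4M}` FROM ONE WEIGHTED TORUS SUM, for the re-keyed source
# block (cure (a) of the located defect «BASE-SRC-ROWS», pen (R207)(7); cell gate-hubbard-kl, seat p3 g18; `--supports` 20440)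

The plain source block of the tower's base (`klSrcPlainBlock·S_{4M}`, multiplier `trivialMultiplier ≡ 1`) has rows `≍ (2/π) ln M`
(`…TowerBaseSrcBlockRows`), so the base (H6) source half must be re-keyed; the pen's default cure (a) reads the slot-`0` source legs through a SMOOTH
band multiplier `F_src`.  This file supplies the rows/columns for ANY such choice, in the currency of the base-transfer bundle (weight
`1 + Λ_T·tnorm(x⃗_Y − x⃗_y)`), and instantiates it at one candidate already controlled in the tree:

* §1 **`sum_norm_smulOverlap_mul_wt_row_le_of_torusSum`**, **`sum_norm_smulOverlap_mul_wt_col_le_of_torusSum`** — for every multiplier family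
  `F : Fin Ns → FreqMomentum V M → ℂ`, every rate `Λ_T ≥ 0` and every bound `T` on the weighted product-torus sums
  `(|β|V²)⁻¹ Σ_{(d,w)} (1 + Λ_T·tnorm w)·‖Σ_k F_ω(k) Χ_c(k; d, w)‖ ≤ T` (all `ω`, `c`): the rows of `ε • E(F)·S_{4M}` weighted by
  `1 + Λ_T·tnorm(x⃗_Y − x⃗_y)` are `≤ ε·T` and the columns `≤ Ns·ε·T` (`ε = imagTimeWeight β M`, `β > 0`);
* §2 (no new declaration) the candidate `F_src := klAnisoFamily V M β μ K₀ klE0 0` for ANY admissible reference frame `K₀` (`FrameOK R U (nScales β) μ K₀`;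
  e.g. the BARE frame `K₀ = 0`, frame-free, via `klFrameOK_zeroC hR.wf U (nScales β) hμ` of `…SplitGlue` at the call site) IS
  `…TowerBaseAliveBlockRows.aliveBlock_wtRows_klEng6` verbatim: weighted rows and columns `≤ 2·(klIsoT + 4·Λ_T·(klE4X0 + 1))`, `M`-, volume-uniform.

Proofs only; no definition.  Honest framing: finite-torus bookkeeping; which multiplier re-keys the base is the cauchy-line registrant's choice (k3c4-p1);
nothing here asserts any stub of 20440, K3, VL or superconductivity.  [cite: BenfattoGiulianiMastropietro2006, §2.7 (2.70)–(2.71a), §3 (3.2)–(3.8)]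
-/

noncomputable section

namespace Summit.HubbardSuperconductivity.HubbardSuperconductivity.Theorems.TwoVolumeSource

set_option linter.dupNamespace false -- summit = problem name (single-conjunct summit), D-0017

open Finset Complex Literature.MathematicalPhysics.QuantumLattice GrassmannAlgebra Literature.Probability.LatticeModels
open Summit.HubbardSuperconductivity.HubbardSuperconductivity.Theorems.KLProgrammeLegKernels
open Summit.HubbardSuperconductivity.HubbardSuperconductivity.Theorems.KLRegimeSplit
open Summit.HubbardSuperconductivity.HubbardSuperconductivity.Theorems.EngineV8
open Summit.HubbardSuperconductivity.HubbardSuperconductivity.Theorems.ScaleZeroDecay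
open Summit.HubbardSuperconductivity.HubbardSuperconductivity.Theorems.TwoVolumeDefect
open scoped ComplexConjugate

variable {V M : ℕ} [NeZero V] [NeZero M]

/-! ## §1 Any multiplier family: weighted rows and columns from ONE weighted torus sum -/

/-- Entries of a scaled overlap block: `‖(ε • E(F)·S) Y y‖ = ε·‖(E(F)·S) Y y‖` (`β > 0`). [folklore] -/
theorem norm_smulOverlap_apply {Ns : ℕ} {β : ℝ} (hβ : 0 < β) (F : Fin Ns → FreqMomentum V M → ℂ) (Y : SpaceTimeIdx V M × SectorLeg Ns)
    (y : GridLeg (GridPoint V (klGridN M))) :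
    ‖((((imagTimeWeight β M : ℝ) : ℂ) • sectorAnalysisMatrix V M β F) * hubbardGridSub V M β (klGridN M)) Y y‖ =
      imagTimeWeight β M * ‖(sectorAnalysisMatrix V M β F * hubbardGridSub V M β (klGridN M)) Y y‖ := by
  have hε : 0 < imagTimeWeight β M := by
    have hM0 : (0 : ℝ) < M := Nat.cast_pos.2 (Nat.pos_of_ne_zero (NeZero.ne M))
    unfold imagTimeWeight
    positivity
  rw [Matrix.smul_mul, Matrix.smul_apply, norm_smul, Complex.norm_real, Real.norm_of_nonneg hε.le]

omit [NeZero M] in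
/-- An overlap kernel vanishes off the legs `((q, σ), c)` of the row's own spin and charge. [folklore] -/
theorem overlap_apply_eq_zero {Ns : ℕ} (β : ℝ) (F : Fin Ns → FreqMomentum V M → ℂ) (x : SpaceTimeIdx V M) (ω : Fin Ns) (σ c : Fin 2)
    (y : GridLeg (GridPoint V (klGridN M))) (h : y.1.2 ≠ σ ∨ y.2 ≠ c) :
    (sectorAnalysisMatrix V M β F * hubbardGridSub V M β (klGridN M)) (x, ((ω, σ), c)) y = 0 := by
  rw [sectorAnalysis_mul_hubbardGridSub_apply, if_neg]
  rintro ⟨h2, h3⟩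
  rcases h with h | h
  · exact h h2
  · exact h h3

/-- **WEIGHTED ROWS OF `ε • E(F)·S_{4M}` FROM ONE WEIGHTED TORUS SUM**: if `(|β|V²)⁻¹ Σ_{(d,w)} (1 + Λ_T·tnorm w)·‖Σ_k F_ω(k) Χ_c(k;d,w)‖ ≤ T` for all
`ω`, `c`, then every row of `ε • E(F)·S_{4M}` weighted by `1 + Λ_T·tnorm(x⃗_Y − x⃗_y)` is `≤ ε·T`. [cite: BenfattoGiulianiMastropietro2006, §2.7 (2.71a)] -/
theorem sum_norm_smulOverlap_mul_wt_row_le_of_torusSum {Ns : ℕ} {β : ℝ} (hβ : 0 < β) (F : Fin Ns → FreqMomentum V M → ℂ) {ΛT T : ℝ}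
    (hT : ∀ (ω : Fin Ns) (c : Fin 2), 1 / (|β| * (V : ℝ) ^ 2) *
        ∑ dw : TorusSite 1 (2 * (2 * M)) × TorusSite 2 V, (1 + ΛT * (Torus.tnorm dw.2 : ℝ)) *
          ‖∑ k : FreqMomentum V M, F ω k *
            (if c = 0 then torusChar (fun _ : Fin 1 => ((k.1 : ℕ) : ZMod (2 * (2 * M)))) dw.1 * torusChar k.2 dw.2
              else conj (torusChar (fun _ : Fin 1 => ((k.1 : ℕ) : ZMod (2 * (2 * M)))) dw.1 * torusChar k.2 dw.2))‖ ≤ T)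
    (Y : SpaceTimeIdx V M × SectorLeg Ns) :
    ∑ y : GridLeg (GridPoint V (klGridN M)),
      ‖((((imagTimeWeight β M : ℝ) : ℂ) • sectorAnalysisMatrix V M β F) * hubbardGridSub V M β (klGridN M)) Y y‖ *
        (1 + ΛT * (Torus.tnorm (Y.1.2 - y.1.1.2) : ℝ)) ≤ imagTimeWeight β M * T := by
  have hM0 : (0 : ℝ) < M := Nat.cast_pos.2 (Nat.pos_of_ne_zero (NeZero.ne M))
  have hε : 0 < imagTimeWeight β M := by unfold imagTimeWeight; positivity
  obtain ⟨x, ⟨⟨ω, σ⟩, c'⟩⟩ := Y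
  have hsum : ∑ y : GridLeg (GridPoint V (klGridN M)),
      ‖((((imagTimeWeight β M : ℝ) : ℂ) • sectorAnalysisMatrix V M β F) * hubbardGridSub V M β (klGridN M)) (x, ((ω, σ), c')) y‖ *
        (1 + ΛT * (Torus.tnorm (x.2 - y.1.1.2) : ℝ)) =
      imagTimeWeight β M * ∑ y : GridLeg (GridPoint V (klGridN M)),
        ‖(sectorAnalysisMatrix V M β F * hubbardGridSub V M β (klGridN M)) (x, ((ω, σ), c')) y‖ * (1 + ΛT * (Torus.tnorm (x.2 - y.1.1.2) : ℝ)) := by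
    rw [Finset.mul_sum]
    exact Finset.sum_congr rfl fun y _ => by rw [norm_smulOverlap_apply hβ, mul_assoc]
  rw [hsum]
  set ψ : TorusSite 1 (2 * (2 * M)) → TorusSite 2 V → ℝ := fun _ w => 1 + ΛT * (Torus.tnorm w : ℝ) with hψ
  have hred : ∑ y : GridLeg (GridPoint V (klGridN M)),
      ‖(sectorAnalysisMatrix V M β F * hubbardGridSub V M β (klGridN M)) (x, ((ω, σ), c')) y‖ * (1 + ΛT * (Torus.tnorm (x.2 - y.1.1.2) : ℝ)) =
      ∑ q : GridPoint V (2 * (2 * M)),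
        ‖(sectorAnalysisMatrix V M β F * hubbardGridSub V M β (2 * (2 * M))) (x, ((ω, σ), c')) ((q, σ), c')‖ *
          ψ (fun _ : Fin 1 => ((q.1 : ℕ) : ZMod (2 * (2 * M))) - 2 * ((x.1 : ℕ) : ZMod (2 * (2 * M)))) (q.2 - x.2) := by
    rw [Fintype.sum_prod_type, Fintype.sum_prod_type]
    refine Finset.sum_congr rfl fun q _ => ?_
    rw [Fintype.sum_eq_single σ fun σ' hσ' => ?_, Fintype.sum_eq_single c' fun c'' hc'' => ?_]
    · simp only [hψ]
      rw [← Torus.tnorm_neg, neg_sub]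
    · rw [overlap_apply_eq_zero β F x ω σ c' ((q, σ), c'') (Or.inr hc''), norm_zero, zero_mul]
    · exact Finset.sum_eq_zero fun c'' _ => by
        rw [overlap_apply_eq_zero β F x ω σ c' ((q, σ'), c'') (Or.inl hσ'), norm_zero, zero_mul]
  rw [hred]
  exact mul_le_mul_of_nonneg_left (rowSum_mul_sectorAnalysis_mul_hubbardGridSub_le_of_weight hβ.ne' F ψ hT ω σ c' x) hε.le

/-- **WEIGHTED COLUMNS OF `ε • E(F)·S_{4M}` FROM ONE WEIGHTED TORUS SUM** (`Λ_T ≥ 0`): every column weighted by `1 + Λ_T·tnorm(x⃗_Y − x⃗_y)` and summed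
over all rows of all `Ns` sectors is `≤ Ns·ε·T`. [cite: BenfattoGiulianiMastropietro2006, §2.7 (2.71a)] -/
theorem sum_norm_smulOverlap_mul_wt_col_le_of_torusSum {Ns : ℕ} {β : ℝ} (hβ : 0 < β) (F : Fin Ns → FreqMomentum V M → ℂ) {ΛT T : ℝ}
    (hΛT : 0 ≤ ΛT)
    (hT : ∀ (ω : Fin Ns) (c : Fin 2), 1 / (|β| * (V : ℝ) ^ 2) *
        ∑ dw : TorusSite 1 (2 * (2 * M)) × TorusSite 2 V, (1 + ΛT * (Torus.tnorm dw.2 : ℝ)) *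
          ‖∑ k : FreqMomentum V M, F ω k *
            (if c = 0 then torusChar (fun _ : Fin 1 => ((k.1 : ℕ) : ZMod (2 * (2 * M)))) dw.1 * torusChar k.2 dw.2
              else conj (torusChar (fun _ : Fin 1 => ((k.1 : ℕ) : ZMod (2 * (2 * M)))) dw.1 * torusChar k.2 dw.2))‖ ≤ T)
    (y : GridLeg (GridPoint V (klGridN M))) :
    ∑ Y : SpaceTimeIdx V M × SectorLeg Ns,
      ‖((((imagTimeWeight β M : ℝ) : ℂ) • sectorAnalysisMatrix V M β F) * hubbardGridSub V M β (klGridN M)) Y y‖ *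
        (1 + ΛT * (Torus.tnorm (Y.1.2 - y.1.1.2) : ℝ)) ≤ Ns * (imagTimeWeight β M * T) := by
  classical
  have hM0 : (0 : ℝ) < M := Nat.cast_pos.2 (Nat.pos_of_ne_zero (NeZero.ne M))
  have hε : 0 < imagTimeWeight β M := by unfold imagTimeWeight; positivity
  obtain ⟨⟨q, σ⟩, c'⟩ := y
  have hsum : ∑ Y : SpaceTimeIdx V M × SectorLeg Ns,
      ‖((((imagTimeWeight β M : ℝ) : ℂ) • sectorAnalysisMatrix V M β F) * hubbardGridSub V M β (klGridN M)) Y ((q, σ), c')‖ *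
        (1 + ΛT * (Torus.tnorm (Y.1.2 - q.2) : ℝ)) =
      imagTimeWeight β M * ∑ Y : SpaceTimeIdx V M × SectorLeg Ns,
        ‖(sectorAnalysisMatrix V M β F * hubbardGridSub V M β (klGridN M)) Y ((q, σ), c')‖ * (1 + ΛT * (Torus.tnorm (Y.1.2 - q.2) : ℝ)) := by
    rw [Finset.mul_sum]
    exact Finset.sum_congr rfl fun Y _ => by rw [norm_smulOverlap_apply hβ, mul_assoc]
  rw [hsum]
  set ψ : TorusSite 1 (2 * (2 * M)) → TorusSite 2 V → ℝ := fun _ w => 1 + ΛT * (Torus.tnorm w : ℝ) with hψ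
  have hψ0 : ∀ d w, 0 ≤ ψ d w := fun d w => by simp only [hψ]; positivity
  have hred : ∑ Y : SpaceTimeIdx V M × SectorLeg Ns,
      ‖(sectorAnalysisMatrix V M β F * hubbardGridSub V M β (klGridN M)) Y ((q, σ), c')‖ * (1 + ΛT * (Torus.tnorm (Y.1.2 - q.2) : ℝ)) =
      ∑ ω : Fin Ns, ∑ x : SpaceTimeIdx V M,
        ‖(sectorAnalysisMatrix V M β F * hubbardGridSub V M β (2 * (2 * M))) (x, ((ω, σ), c')) ((q, σ), c')‖ *
          ψ (fun _ : Fin 1 => ((q.1 : ℕ) : ZMod (2 * (2 * M))) - 2 * ((x.1 : ℕ) : ZMod (2 * (2 * M)))) (q.2 - x.2) := by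
    rw [Fintype.sum_prod_type, Finset.sum_comm, Fintype.sum_prod_type, Fintype.sum_prod_type]
    refine Finset.sum_congr rfl fun ω _ => ?_
    rw [Fintype.sum_eq_single σ fun σ' hσ' => ?_]
    · rw [Fintype.sum_eq_single c' fun c'' hc'' => ?_]
      · refine Finset.sum_congr rfl fun x _ => ?_
        simp only [hψ]
        rw [← Torus.tnorm_neg, neg_sub]
      · exact Finset.sum_eq_zero fun x _ => by
          rw [overlap_apply_eq_zero β F x ω σ c'' ((q, σ), c') (Or.inr (Ne.symm hc'')), norm_zero, zero_mul]
    · exact Finset.sum_eq_zero fun c'' _ => Finset.sum_eq_zero fun x _ => by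
        rw [overlap_apply_eq_zero β F x ω σ' c'' ((q, σ), c') (Or.inl (Ne.symm hσ')), norm_zero, zero_mul]
  rw [hred]
  have h := colSum_mul_sectorAnalysis_mul_hubbardGridSub_le_of_weight hβ.ne' F ψ hψ0 hT σ c' q
  calc imagTimeWeight β M * _ ≤ imagTimeWeight β M * (Ns * T) := mul_le_mul_of_nonneg_left h hε.le
    _ = Ns * (imagTimeWeight β M * T) := by ring

end Summit.HubbardSuperconductivity.HubbardSuperconductivity.Theorems.TwoVolumeSource

end
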